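import Summits.BirchSwinnertonDyer.BirchSwinnertonDyer.Theorems.EisensteinPrimesMazurMCOnX1RankZeroInterludeRoadBResidueP
import Summits.BirchSwinnertonDyer.BirchSwinnertonDyer.Theorems.EisensteinPrimesMazurMCOnX1RankZeroInterludeDefs
import Literature.NumberTheory.EllipticCurves.SelmerCorankProofs
import HarnessLib

/-!
# Road B at degree `p` from (B3) FOR CONTINUOUS ACTIONS — add-on to the LEAD's landed `…InterludeRoadBResidueP`

Ideator bsd-idea-11 (lens `nearmiss`), generation 16 — tree-ready crux workfile (publish-only; the LEAD `cruxlead-19035` lands it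
if it chooses the road-B reshape). Sorry-free. NO summit statement, crux or stub is proved: the theorem is conditional on the
continuous-action form of the residual `GL(1)` finiteness (B3).

`@[conjecture] def ResidualGL1FinitenessOddCont` = (B3) body + antecedent «∀ m, Continuous (σ : Γ_K ↦ σ • m)» (a displayed input, not
proved), and `kerSelmerMapFiniteOfDegreeP_of_residualCont : ResidualGL1FinitenessOddCont → InterludeWithTorsion.KerSelmerMapFiniteOfDegreeP`
((B1c) at degree `p`, BY NAME, tree `…InterludeDefs`). The def is token for token `RoadBHelpers.ResidualGL1FinitenessOddCont` of the workfile
`Cruxes/MazurMCOnX1RankZero/Lines/interlude_roadB_GL1Reduction_treeready_idea11g16.lean` (§ContinuousVariant), where it is reduced to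
the two junk-free classical `μ = 0` inputs `GL1InputUnramifiedCont` / `GL1InputSplitPrimeCont` (the tame input [P23] being a kernel
theorem for continuous actions). PROOF: the LEAD's `RoadBHelpers.finite_selmerAc_inter_ker_h1Map_extendScalars` wants the finiteness
`hR` only at `M := E[ψ₀]` with the restricted action `RoadBHelpers.kerResAction`; that action is CONTINUOUS — `E(ℚ̄)` is a discrete
`Γ_ℚ`-module (`WeierstrassCurve.continuous_smul_geomPoints`), `absGaloisRestrict ℚ K` is continuous, and `E[ψ₀]` carries the
subspace topology — so the continuous-action form of (B3) supplies `hR`; the kernel then injects as in the LEAD's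
`kerSelmerMapFiniteOfDegreeP_of_residualGL1FinitenessOdd`. [cite: GreenbergLNM1716, §5, proof of Prop. 5.10]
[cite: GreenbergVatsal2000, §2 (Prop. 2.8 and its proof)] [cite: SilvermanAEC2009, VII.§4 Thm. VII.4.1]
-/

noncomputable section

set_option linter.dupNamespace false

open scoped Classical

namespace Summit.BirchSwinnertonDyer.BirchSwinnertonDyer.Theorems.InterludeWithTorsion

open AddSubgroup Field WeierstrassCurve NumberField IsDedekindDomain
  Literature.NumberTheory.EllipticCurves Literature.NumberTheory.EllipticCurves.GreenbergSelmer
  Literature.NumberTheory.GaloisRepresentations Literature.NumberTheory.EllipticCurves.IsogenySelmerInfty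
  Literature.NumberTheory.EllipticCurves.Castella2018 Literature.NumberTheory.EllipticCurves.Castella2018.AcSelmer

/-- **(B3) for CONTINUOUS actions** — the body of the registered `InterludeWithTorsion.ResidualGL1FinitenessOdd` ((B3), tree
`…InterludeDefs`) with the extra antecedent «`∀ m, Continuous (σ : Γ_K ↦ σ • m)`». WEAKER than (B3)
(`residualGL1FinitenessOddCont_of_residualGL1FinitenessOdd`) and sufficient for road B (`kerSelmerMapFiniteOfDegreeP_of_residualCont`);
reduced in the workfile `Lines/interlude_roadB_GL1Reduction_treeready_idea11g16.lean` §ContinuousVariant (same body, namespace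
`…RoadBHelpers`) to the two classical `μ = 0` inputs [P1]-cont / [Cv]-cont, the tame input [P23] being a theorem for continuous
actions. Informal: for `K` imaginary quadratic, `p` odd split, `κ` cyclotomic, `S` finite and `M` of order `p` with a CONTINUOUS
`Γ_K`-action restricted from `Γ_ℚ`, Greenberg's residual strict Selmer group `Sel^{str v̄}_S(K_∞, M)` is finite — Greenberg's
`GL(1)` input (LNM 1716 §5, proof of Prop. 5.10; Greenberg–Vatsal 2000 Prop. (2.4)), i.e. `μ = 0` for the two `𝔽_p`-characters.
A candidate road-B stub for a LEAD reshape of `interlude_with_torsion` (not registered by this file). [cite: GreenbergLNM1716, §5,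
proof of Prop. 5.10] [cite: GreenbergVatsal2000, §2 Prop. (2.4)] -/
@[conjecture] def ResidualGL1FinitenessOddCont : Prop :=
  ∀ (K : Type) [Field K] [NumberField K], IsImaginaryQuadratic K →
    ∀ (p : ℕ) [Fact p.Prime], p ≠ 2 →
    ∀ (κ : ZpExtension K p), κ.IsCyclotomic →
    ∀ (v vbar : HeightOneSpectrum (𝓞 K)), ((p : ℕ) : 𝓞 K) ∈ v.asIdeal → ((p : ℕ) : 𝓞 K) ∈ vbar.asIdeal →
      vbar ≠ v →
    ∀ (S : Set (HeightOneSpectrum (𝓞 K))), S.Finite →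
    ∀ (M : Type) [AddCommGroup M] [DistribMulAction (absoluteGaloisGroup ℚ) M]
      [DistribMulAction (absoluteGaloisGroup K) M] [TopologicalSpace M] [DiscreteTopology M],
      Nat.card M = p →
      (∀ (σ : absoluteGaloisGroup K) (m : M), σ • m = (absGaloisRestrict ℚ K σ) • m) →
      (∀ m : M, Continuous fun σ : absoluteGaloisGroup K ↦ σ • m) →
      (GreenbergVatsal2000.datumStrictSelmer κ.kerSubgroup M p (AcSelmer.bdpData M p vbar) S :
        Set (subgroupH1 κ.kerSubgroup M)).Finite

/-- (B3) ⟹ its continuous-action form (weakening). [folklore] -/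
theorem residualGL1FinitenessOddCont_of_residualGL1FinitenessOdd (h : ResidualGL1FinitenessOdd) :
    ResidualGL1FinitenessOddCont :=
  fun K _ _ hK p _ hp2 κ hκ v vbar hpv hpvbar hne S hS M _ _ _ _ _ hcard hprov _ ↦
    h K hK p hp2 κ hκ v vbar hpv hpvbar hne S hS M hcard hprov

/-- **(B1c) at degree `p` from (B3) FOR CONTINUOUS ACTIONS** — `InterludeWithTorsion.KerSelmerMapFiniteOfDegreeP` BY NAME from the
body of (B3) `ResidualGL1FinitenessOdd` weakened by the antecedent «the `Γ_K`-action on `M` is continuous» (= workfile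
`RoadBHelpers.ResidualGL1FinitenessOddCont`, token for token). Road B instantiates (B3) only at `M = E[ψ₀]`, whose action is
continuous, so the junk case of (B3) (non-continuous actions) is never needed. [cite: GreenbergLNM1716, §5, proof of Prop. 5.10]
[cite: GreenbergVatsal2000, §2 (Prop. 2.8 and its proof)] -/
theorem kerSelmerMapFiniteOfDegreeP_of_residualCont (hGL1c : ResidualGL1FinitenessOddCont) :
    InterludeWithTorsion.KerSelmerMapFiniteOfDegreeP := by
  intro W W' _ _ p _ hp2 _ _ ψ₀ hdeg K _ _ hK v vbar hpv hpvbar hne κ hκ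
  letI := ψ₀.kerAction
  letI := RoadBHelpers.kerResAction ψ₀ K
  -- the Galois action on `E[ψ₀] ⊆ E(ℚ̄)` is continuous, hence so is the restricted `Γ_K`-action
  have hcontK : ∀ m : ↥ψ₀.toAddMonoidHom.ker, Continuous fun σ : absoluteGaloisGroup K ↦ σ • m := fun m ↦ by
    refine continuous_induced_rng.2 ?_
    show Continuous ((fun τ : absoluteGaloisGroup ℚ ↦ τ • (m : W.geomPoints)) ∘ (absGaloisRestrict ℚ K))
    exact (W.continuous_smul_geomPoints (m : W.geomPoints)).comp (absGaloisRestrict ℚ K).continuous_toFun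
  have hR := hGL1c K hK p hp2.ne' κ hκ v vbar hpv hpvbar hne ((W.baseChange K).badPlaces (𝓞 K))
    ((W.baseChange K).finite_badPlaces_holds (𝓞 K)) ↥ψ₀.toAddMonoidHom.ker hdeg (fun _ _ ↦ rfl) hcontK
  have hfin := RoadBHelpers.finite_selmerAc_inter_ker_h1Map_extendScalars p ψ₀ K hdeg hK.1 hpv hpvbar hne κ hκ hR
  haveI := hfin.to_subtype
  refine Finite.of_injective
    (fun c ↦ (⟨((c.1 : selmerAc (W.baseChange K) p κ vbar ∅) : (W.baseChange K).subgroupH1 p κ.kerSubgroup),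
        (c.1 : selmerAc (W.baseChange K) p κ vbar ∅).2,
        congrArg Subtype.val ((AddMonoidHom.mem_ker).1 c.2)⟩ :
      {c : (W.baseChange K).subgroupH1 p κ.kerSubgroup | c ∈ selmerAc (W.baseChange K) p κ vbar ∅ ∧
        h1Map p κ.kerSubgroup (ψ₀.extendScalars K).toAddMonoidHom (ψ₀.extendScalars K).equivariant c = 0}))
    (fun a b h ↦ by
      simp only [Subtype.mk.injEq] at h
      exact Subtype.ext (Subtype.ext h))

/-- The same with the registered (B3) `ResidualGL1FinitenessOdd` BY NAME (weakening the hypothesis): a second proof of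
`RoadBResidueP`, factoring through the continuous-action form. [cite: GreenbergLNM1716, §5, proof of Prop. 5.10] -/
theorem roadBResidueP_of_residualCont_route : InterludeWithTorsion.RoadBResidueP := fun hGL1 ↦
  kerSelmerMapFiniteOfDegreeP_of_residualCont (residualGL1FinitenessOddCont_of_residualGL1FinitenessOdd hGL1)

end Summit.BirchSwinnertonDyer.BirchSwinnertonDyer.Theorems.InterludeWithTorsion

end
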